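import Summits.KontsevichZagierPeriods.KontsevichZagierPeriods.Theses.HurwitzMicroSectors
import Summits.KontsevichZagierPeriods.KontsevichZagierPeriods.Theorems.HurwitzMicroSectorsNormalFormPrinciplePiBoxTransfer
import Summits.KontsevichZagierPeriods.KontsevichZagierPeriods.Theorems.HurwitzMicroSectorsNormalFormPrincipleVariants2293

/-! TTRL-lite variant V2294 of stmt-KontsevichZagierPeriods-3869

Variant V2294 = `stub_boxRigidity` (the leaf `BoxRigidity` of `NormalFormPrinciple`: two BOX-RATIONAL
representations — domain the open unit box, integrand `p/q` over `ℚ` — with equal values are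
KZ-equivalent) under the two-sided move `bound_nat:m≤5; bound_nat:m'≤5`. Verdict of the attempt seat:
**open** — this file is the exact-strength certificate, not a proof of the variant.
* V2294 is, verbatim, the right-hand side of the tree's `stub_boxRigidity_var2293_iff_le_five`, so
  `V2294 ⟺ V2293 ⟺ BoxVanishing 5` (every box-rational representation on `(0,1)⁵` of value `0` is a
  relation): `stub_boxRigidity_var2294_iff_var2293`, `stub_boxRigidity_var2294_iff_boxVanishing_five`;
  downward it gives `BoxVanishing j` for every `j ≤ 5` (`boxVanishing_le_five_of_stub_boxRigidity_var2294`).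
* What IS a theorem: the sub-case `m, m' ≤ 1` of V2294 (already landed verbatim as
  `stub_boxRigidity_var2229_slice_le_one`, file `…Variants2229`, from `Dlog.boxRigidity_of_le_one`, Baker). From dimension `2` on `BoxVanishing` is open: dimension `2`
  contains, for every `c : ℚ`, "`G = c ⇒ [(0,1)², c − 1/(1+x²y²)]` is a relation" (`G` = Catalan's
  constant), dimension `5` the same dichotomy for `ζ(5) = ∫_{(0,1)⁵} dx/(1 − x₁⋯x₅)`; the side conditions
  of every move are independent of the value, a chain at `c` forces the value equation by soundness, so a
  proof must refute the equation for all but one rational `c` — an irrationality theorem nobody has.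
* Upward `KontsevichZagierPeriods ⇒ parent leaf ⇒ V2294` (`stub_boxRigidity_var2294_of_statement`), so a
  refutation of V2294 would refute the Summit (Conjecture 1 for the tree's calculus); the tree has no
  invariant of `KZ.relations` finer than `KZ.eval`.
Residual goal: `BoxVanishing 5`. Source: M. Kontsevich, D. Zagier, *Periods* (2001), §1.2 Conjecture 1
and rules 1)–3). Pure proof file, no definitions. -/

-- `Summit.<Summit>.<Problem>` is the tree's mandated summit-side namespace (CONVENTIONS §2); for this
-- single-conjunct summit the two coincide, so the duplicate is deliberate.
set_option linter.dupNamespace false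

noncomputable section

namespace Summit.KontsevichZagierPeriods.KontsevichZagierPeriods.Theorems

open MeasureTheory Set
open Literature.NumberTheory.Transcendental Literature.NumberTheory.Transcendental.KZ
open Summit.KontsevichZagierPeriods.KontsevichZagierPeriods.Theses.HurwitzMicroSectors
open Summit.KontsevichZagierPeriods.HurwitzMicroSectors.NormalFormPrinciple.PiBox

/-! ## The variant V2294 is exactly `BoxVanishing 5` -/

/-- **V2294 ⟺ the sibling V2293** (`fix_nat:m=5; bound_nat:m'≤5`): V2294 is literally the bounded leaf
`BoxRigidity(m, m' ≤ 5)` of `stub_boxRigidity_var2293_iff_le_five`.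
[cite: KontsevichZagier2001, §1.2 Conjecture 1] -/
theorem stub_boxRigidity_var2294_iff_var2293 :
    (∀ (m m' : ℕ) (N : IntegralRep m) (N' : IntegralRep m'), m' ≤ 5 → m ≤ 5 → N.domain = {x | ∀ i, x i ∈ Set.Ioo (0:ℝ) 1} → N.IsRational → N'.domain = {x | ∀ i, x i ∈ Set.Ioo (0:ℝ) 1} → N'.IsRational → N.value = N'.value → Equivalent N N') ↔
    (∀ (m' : ℕ) (N : IntegralRep 5) (N' : IntegralRep m'), m' ≤ 5 →
      N.domain = {x | ∀ i, x i ∈ Set.Ioo (0:ℝ) 1} → N.IsRational →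
      N'.domain = {x | ∀ i, x i ∈ Set.Ioo (0:ℝ) 1} → N'.IsRational →
      N.value = N'.value → Equivalent N N') :=
  stub_boxRigidity_var2293_iff_le_five.symm

/-- **V2294 ⟺ `BoxVanishing 5`** — the exact strength of the variant: every box-rational representation
on `(0,1)⁵` of value `0` is a KZ relation (forward: compare with the zero representation; backward: pad
both representations to the `5`-box by Newton–Leibniz moves and subtract there, value `0` by soundness).
[cite: KontsevichZagier2001, §1.2 Conjecture 1] -/
theorem stub_boxRigidity_var2294_iff_boxVanishing_five :
    (∀ (m m' : ℕ) (N : IntegralRep m) (N' : IntegralRep m'), m' ≤ 5 → m ≤ 5 → N.domain = {x | ∀ i, x i ∈ Set.Ioo (0:ℝ) 1} → N.IsRational → N'.domain = {x | ∀ i, x i ∈ Set.Ioo (0:ℝ) 1} → N'.IsRational → N.value = N'.value → Equivalent N N') ↔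
    (∀ (N : IntegralRep 5), N.domain = {x | ∀ i, x i ∈ Set.Ioo (0:ℝ) 1} → N.IsRational →
      N.value = 0 → of N ∈ relations) :=
  stub_boxRigidity_var2294_iff_var2293.trans stub_boxRigidity_var2293_iff_boxVanishing_five

/-- **V2294 ⇒ `BoxVanishing` in every dimension `j ≤ 5`** (monotonicity along padding); the first open
level is `j = 2` (Catalan / dilogarithm relations), level `5` carries the `ζ(5)` dichotomy.
[cite: KontsevichZagier2001, §1.2 Conjecture 1] -/
theorem boxVanishing_le_five_of_stub_boxRigidity_var2294
    (h : ∀ (m m' : ℕ) (N : IntegralRep m) (N' : IntegralRep m'), m' ≤ 5 → m ≤ 5 → N.domain = {x | ∀ i, x i ∈ Set.Ioo (0:ℝ) 1} → N.IsRational → N'.domain = {x | ∀ i, x i ∈ Set.Ioo (0:ℝ) 1} → N'.IsRational → N.value = N'.value → Equivalent N N')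
    {j : ℕ} (hj : j ≤ 5) (N : IntegralRep j) (hNd : N.domain = {x | ∀ i, x i ∈ Set.Ioo (0:ℝ) 1})
    (hNr : N.IsRational) (hv : N.value = 0) : of N ∈ relations :=
  boxVanishing_le_five_of_stub_boxRigidity_var2293 (stub_boxRigidity_var2294_iff_var2293.1 h) hj N hNd
    hNr hv

/-- **`BoxVanishing 5` alone already proves V2294** (the honest residual: whoever settles Conjecture 1
for vanishing box-rational periods of dimension `5` settles V2294, and conversely).
[cite: KontsevichZagier2001, §1.2 Conjecture 1] -/
theorem stub_boxRigidity_var2294_of_boxVanishing_five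
    (hvan : ∀ (N : IntegralRep 5), N.domain = {x | ∀ i, x i ∈ Set.Ioo (0:ℝ) 1} → N.IsRational →
      N.value = 0 → of N ∈ relations) :
    ∀ (m m' : ℕ) (N : IntegralRep m) (N' : IntegralRep m'), m' ≤ 5 → m ≤ 5 → N.domain = {x | ∀ i, x i ∈ Set.Ioo (0:ℝ) 1} → N.IsRational → N'.domain = {x | ∀ i, x i ∈ Set.Ioo (0:ℝ) 1} → N'.IsRational → N.value = N'.value → Equivalent N N' :=
  stub_boxRigidity_var2294_iff_boxVanishing_five.2 hvan

/-! ## The variant from above -/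

/-- **The parent leaf ⇒ V2294** (both dimension bounds are simply dropped; the converse is not claimed —
the parent is `BoxVanishing` in ALL dimensions). [cite: KontsevichZagier2001, §1.2 Conjecture 1] -/
theorem stub_boxRigidity_var2294_of_parent
    (h : ∀ (m m' : ℕ) (N : IntegralRep m) (N' : IntegralRep m'), N.domain = {x | ∀ i, x i ∈ Set.Ioo (0:ℝ) 1} → N.IsRational → N'.domain = {x | ∀ i, x i ∈ Set.Ioo (0:ℝ) 1} → N'.IsRational → N.value = N'.value → Equivalent N N') :
    ∀ (m m' : ℕ) (N : IntegralRep m) (N' : IntegralRep m'), m' ≤ 5 → m ≤ 5 → N.domain = {x | ∀ i, x i ∈ Set.Ioo (0:ℝ) 1} → N.IsRational → N'.domain = {x | ∀ i, x i ∈ Set.Ioo (0:ℝ) 1} → N'.IsRational → N.value = N'.value → Equivalent N N' :=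
  fun m m' N N' _ _ => h m m' N N'

/-- **`KontsevichZagierPeriods ⇒ V2294`**: the variant is a special case of Conjecture 1 for the tree's
calculus (`leaves_of_statement`) — so a refutation of the variant would refute the Summit.
[cite: KontsevichZagier2001, §1.2 Conjecture 1] -/
theorem stub_boxRigidity_var2294_of_statement (h : _root_.KontsevichZagierPeriods) :
    ∀ (m m' : ℕ) (N : IntegralRep m) (N' : IntegralRep m'), m' ≤ 5 → m ≤ 5 → N.domain = {x | ∀ i, x i ∈ Set.Ioo (0:ℝ) 1} → N.IsRational → N'.domain = {x | ∀ i, x i ∈ Set.Ioo (0:ℝ) 1} → N'.IsRational → N.value = N'.value → Equivalent N N' :=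
  stub_boxRigidity_var2294_of_parent (leaves_of_statement h).1

end Summit.KontsevichZagierPeriods.KontsevichZagierPeriods.Theorems

end
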